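import Summits.Ventures.HSemireg.Pad4TowerXInfMu4A
import Summits.Ventures.HSemireg.Pad4TowerFrameLift
import Summits.Ventures.HSemireg.Pad4TowerXInf

/-!
# Venture HSemireg — PAD-4: THEOREM X∞ on the balanced lattice 𝔅(μ₄), ALL FOUR PHASES, in the kernel (part B: the frame
# transfer of the fully charged world, LEMMA X∞-B, the theorem, the ¬(H1) corollary for FILE-A designs, non-vacuity)

HONEST FRAMING. Fourth of four files (see `Pad4TowerAlphabetMu4`); seat `hodge-semireg-assembly-p1` g1 (W2 «assembly from typed
lemmas», director-hodge g10 l.31377). Source: bc5-plan g4, BC5-PLAN-g4-MEMO.md v4.1 df3e4f41db3c2fcf §5 THEOREM X∞ (pencil ×1; LEG A ∕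
LEG B referee reads on the bus) and §6 «the μ₄ statement is the same with four null directions per factor; the (F1ℝ) slice is a
faithful restriction because every step of §1–§4 stays inside the phases already present except the ONE sibling in §2 (N_c)». The
(F1ℝ) slice is the kernel theorem `Pad4TowerXInf.xinf_muC_eq_zero` ∕ `Admissible.no_fc` (this seat g0, p554399). THIS FILE makes
the μ₄ sentence a kernel theorem, ASSEMBLED FROM TYPED LEMMAS: §2–§3 (the O-factor half) is `Pad4TowerXInfMu4A`, natively on 𝔅(μ₄);
§4 (the fully charged half) is REDUCED to the (F1ℝ) kernel theorem by the frame transfer below — the memo's faithfulness remark,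
proved rather than cited, for the part of the proof where it is literally true (no O-factor, hence no sibling and no phase choice).

WHAT IS PROVED.
* §3 `frameConfig ε C` — the fully charged cells of `C` read in the frames `ε` as a `Pad4TowerLemmaT.Config` — and
  **`admissible_frameConfig`**: for an ADMISSIBLE 𝔅(μ₄) configuration it is (F1ℝ)-ADMISSIBLE (`Pad4TowerXInfB.Admissible`): letters
  in `𝒰` (`inUscr_of_framePt`); RULE D of `Pad4TowerLemmaT` on both levels, because every μ₄ server ∕ (r2a) cover of a fully charged
  cell stays in the cell's frames (`Pad4TowerFrameLift` §2) and is fully charged (COROLLARY A′, `AdmissibleMu4.fc_of_agree`)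
  (`frame_servedBelow∕Above`, `frame_coverBelow∕Above`); PSC and X-cleanness vacuously (no O-factor).
* §4 **`AdmissibleMu4.no_fc`** (LEMMA X∞-B on 𝔅(μ₄): no fully charged cell — `Admissible.no_fc` applied in the frames of the cell's
  own phases), **`AdmissibleMu4.junk`** = **THEOREM X∞ ON 𝔅(μ₄)**: every cell of an admissible configuration has all factors but at
  most one equal to `O` (`card_charged_le_one`). No Ψ-row, no FC1, no universe, no height bound, no `decide`.
* §5 **`Design.mu_eq_zero_of_admissibleMu4`** ∕ `Design.not_H1_of_admissibleMu4`: a FILE-A design (`Pad4FirstOrderModel.Design`,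
  any phases in μ₄, multiplicities by repetition) whose support `designConfig D` (FILE-A seam `mcellOfConstituent`) is admissible has
  `μ = 0`, i.e. `¬ H1` — the memo's §5 COROLLARY in FILE A's own `mu`∕`H1`.
* §6 `junkExampleMu4_admissible`: `{[O|O|O|2ℓ_u]}_u ∪ {[O|O|O|ℓ_u]}_u`, all four phases, IS admissible (kernel `decide`) — the
  hypotheses are satisfiable with genuinely μ₄ data, and PSC forces all four phases to appear.

WHAT IS NOT HERE ∕ NOT IN LEAN. The (E1)∕(H2) MEANING of the hypotheses — that (H2) implies RULE-D-closure (PAIR-IMAGE THEOREM,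
PAD4-BALANCED §1′) and X-cleanness (LEMMA X-PHASE §22, THEOREM P ∕ PAD4-LEAK) — is the cell's pencil (×2 ∕ ×1 as recorded there), so
«no (H1)+(H2) design with PSC support in 𝒰⁴» is NOT a kernel sentence: the kernel sentence is «admissible ⇒ junk ⇒ μ = 0». Not here
either: the residues R1–R4 of memo §7 (bare nodes, letters off the levels {0,2}, phase-poor supports, three-level designs, (F2)
letters); G-invariant ⇒ PSC. Nothing is a statement about a variety, a sheaf, `σ`, a seed or an abelian variety; NOTHING HERE SAYS
THAT HC ∕ HC_CM ∕ HC_AV ∕ W₆ ∕ HC_Kum4Type HOLDS OR FAILS. No `instance`, no notation, no named fact, 0 `sorry`; axioms standard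
(`AdmissibleMu4.junk`, `Design.mu_eq_zero_of_admissibleMu4`, `junkExampleMu4_admissible`: propext, Classical.choice, Quot.sound).

SOURCES (sha16): BC5-PLAN-g4-MEMO.md v4.1 df3e4f41db3c2fcf §0–§6 (byte-identical in v4.8 97cc7726c3e53c00); `Pad4TowerXInf.lean`
325d71e7d3623911 (p554399) + `Pad4TowerXInfB.lean` 7a5a6e6ccf1e82da (p551417) + `Pad4TowerXInfA.lean` 69fd0bbeca40d0fc (p548762) (the
(F1ℝ) kernel theorem and its `Admissible`); `Pad4TowerRuleDMu4.lean` 7f3a78a9d76f5e0c (p551028) + `Pad4TowerRuleDMu4Slice.lean`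
19fb9aba7eb52cda (p554734) (typer-2 g2: RULE D on 𝔅(μ₄), the slice theorem this transfer generalises one frame per factor);
`Pad4TowerCrossPhase.lean` 8f09792281b0723a; `Pad4FirstOrderModel.lean` b6b3015efa20709e (p505821: `Design`, `mu`, `H1`);
`Pad4TowerLlite.lean` 60030679fa008459 (`bpointOfConstituent`); `Pad4TowerAlphabetMu4 ∕ XInfMu4A ∕ FrameLift` (this seat, same filing).
-/

namespace Summit.Ventures.HSemireg.Pad4Tower

open Finset

/-! ## §3 The fully charged part of an admissible 𝔅(μ₄) configuration, read in its own frames, is (F1ℝ)-admissible -/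

/-- the (F1ℝ) configuration of the FULLY CHARGED cells of `C` read in the frames `ε` (one frame direction per factor): the
cells `Y` whose frame lift is a fully charged cell of `C`, on either level. -/
noncomputable def frameConfig (ε : Fin 4 → Fin 4) (C : MConfig) : Config where
  lower := (C.lower.filter fun X => FCMu4 X).preimage (frameLift ε) (frameLift_injective ε).injOn
  upper := (C.upper.filter fun X => FCMu4 X).preimage (frameLift ε) (frameLift_injective ε).injOn

/-- membership, lower level. -/
theorem mem_frameConfig_lower {ε : Fin 4 → Fin 4} {C : MConfig} {Y : Cell} :
    Y ∈ (frameConfig ε C).lower ↔ frameLift ε Y ∈ C.lower ∧ FCMu4 (frameLift ε Y) := by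
  rw [frameConfig, Finset.mem_preimage, Finset.mem_filter]

/-- membership, upper level. -/
theorem mem_frameConfig_upper {ε : Fin 4 → Fin 4} {C : MConfig} {Y : Cell} :
    Y ∈ (frameConfig ε C).upper ↔ frameLift ε Y ∈ C.upper ∧ FCMu4 (frameLift ε Y) := by
  rw [frameConfig, Finset.mem_preimage, Finset.mem_filter]

/-- fully charged (F1ℝ) cells are exactly those with a fully charged frame lift. -/
theorem fc_iff_frameLift (ε : Fin 4 → Fin 4) (Y : Cell) : FC Y ↔ FCMu4 (frameLift ε Y) :=
  forall_congr' fun f => not_congr (isO_iff_frameLift ε Y f)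

section Transfer

variable {C : MConfig} (hA : AdmissibleMu4 C) (ε : Fin 4 → Fin 4)
include hA

/-- a server BELOW the lift of `Y` on `g`, in a direction not antipodal to the side `s`, is the lift of an (F1ℝ) leg of `Y`
along `(g, s)` — fully charged by COROLLARY A′. -/
theorem frame_servedBelow {Y : Cell} (hX : frameLift ε Y ∈ C.lower) (hfc : FCMu4 (frameLift ε Y)) {g r : Fin 4}
    {s : Fin 2} (hr : r ≠ ε g + dirOf s + 2) {P : MCell} (hPu : P ∈ C.upper) (hP : UPartner (frameLift ε Y) P g r) :
    ServedBelow (frameConfig ε C) Y g s := by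
  obtain ⟨hag, hlt, hray⟩ := hP
  have hvg : Y g 0 ≠ Y g 1 := ne_of_inU_framePt (hA.uN _ hX g) (hfc g)
  obtain ⟨w, hw, hwu, hws⟩ := below_framePt_side hvg (hA.uP P hPu g) hlt hray s hr
  have hP' : P = frameLift ε (Function.update Y g w) := by
    rw [frameLift_update]; funext f
    by_cases hf : f = g
    · subst hf; rw [Function.update_self]; exact hw
    · rw [Function.update_of_ne hf]; exact hag f hf
  obtain ⟨a, hag', -⟩ := exists_fourth g g g
  obtain ⟨b, hbg, -, hba⟩ := exists_fourth g g a
  have hPfc : FCMu4 P := hA.fc_of_agree (Or.inr hPu) hfc (Ne.symm hba) (hag a hag') (hag b hbg)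
  rw [hP'] at hPu hPfc
  refine ⟨_, mem_frameConfig_upper.2 ⟨hPu, hPfc⟩, fun f u hfu => ?_, by rw [Function.update_self]; exact hws⟩
  by_cases hf : f = g
  · subst hf; rw [Function.update_self]; exact hwu u fun hu => hfu ⟨rfl, hu⟩
  · rw [Function.update_of_ne hf]

/-- a server ABOVE the lift of `Y` on `g`, in a direction not antipodal to the side `s`, is the lift of an (F1ℝ) server. -/
theorem frame_servedAbove {Y : Cell} (hX : frameLift ε Y ∈ C.upper) (hfc : FCMu4 (frameLift ε Y)) {g r : Fin 4}
    {s : Fin 2} (hr : r ≠ ε g + dirOf s + 2) {N : MCell} (hNl : N ∈ C.lower) (hN : UPartner N (frameLift ε Y) g r) :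
    ServedAbove (frameConfig ε C) Y g s := by
  obtain ⟨hag, hlt, hray⟩ := hN
  have hvg : Y g 0 ≠ Y g 1 := ne_of_inU_framePt (hA.uP _ hX g) (hfc g)
  have hU : InUMu4 (ray (framePt (ε g) (Y g)) r ((N g).1 - (frameLift ε Y g).1)) := by
    have := hA.uN N hNl g; rwa [hray] at this
  obtain ⟨w, hw, hwu, hws⟩ := above_framePt_side hvg (by omega) hU s hr
  have hN' : N = frameLift ε (Function.update Y g w) := by
    rw [frameLift_update]; funext f
    by_cases hf : f = g
    · subst hf; rw [Function.update_self, hray]; exact hw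
    · rw [Function.update_of_ne hf]; exact (hag f hf).symm
  obtain ⟨a, hag', -⟩ := exists_fourth g g g
  obtain ⟨b, hbg, -, hba⟩ := exists_fourth g g a
  have hNfc : FCMu4 N := hA.fc_of_agree (Or.inl hNl) hfc (Ne.symm hba) (hag a hag').symm (hag b hbg).symm
  rw [hN'] at hNl hNfc
  refine ⟨_, mem_frameConfig_lower.2 ⟨hNl, hNfc⟩, fun f u hfu => ?_, by rw [Function.update_self]; exact hws⟩
  by_cases hf : f = g
  · subst hf; rw [Function.update_self]; exact hwu u fun hu => hfu ⟨rfl, hu⟩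
  · rw [Function.update_of_ne hf]

/-- a cover BELOW the lift of `Y` moving `g` and `j` is the lift of an (F1ℝ) (r2a) cover along `(g, s)`, `(j, t)`. -/
theorem frame_coverBelow {Y : Cell} (hX : frameLift ε Y ∈ C.lower) (hfc : FCMu4 (frameLift ε Y)) {g j : Fin 4}
    (hgj : g ≠ j) {s t : Fin 2} (h : CoveredBelow C (frameLift ε Y) g (ε g + dirOf s) j (ε j + dirOf t)) :
    CoverBelow (frameConfig ε C) Y g s j t := by
  obtain ⟨a, b, ha, hb, P, hPu, hag, hltg, hrayg, hltj, hrayj⟩ := h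
  have hvg : Y g 0 ≠ Y g 1 := ne_of_inU_framePt (hA.uN _ hX g) (hfc g)
  have hvj : Y j 0 ≠ Y j 1 := ne_of_inU_framePt (hA.uN _ hX j) (hfc j)
  obtain ⟨w, hw, hwu, hws⟩ := below_framePt_side hvg (hA.uP P hPu g) hltg hrayg s ha.ne_add_two
  obtain ⟨w', hw', hwu', hws'⟩ := below_framePt_side hvj (hA.uP P hPu j) hltj hrayj t hb.ne_add_two
  have hP' : P = frameLift ε (Function.update (Function.update Y g w) j w') := by
    rw [frameLift_update, frameLift_update]; funext f
    by_cases hfj : f = j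
    · subst hfj; rw [Function.update_self]; exact hw'
    rw [Function.update_of_ne hfj]
    by_cases hfg : f = g
    · subst hfg; rw [Function.update_self]; exact hw
    · rw [Function.update_of_ne hfg]; exact hag f hfg hfj
  obtain ⟨a', ha'g, ha'j, -⟩ := exists_fourth g j j
  obtain ⟨b', hb'g, hb'j, hb'a'⟩ := exists_fourth g j a'
  have hPfc : FCMu4 P := hA.fc_of_agree (Or.inr hPu) hfc (Ne.symm hb'a') (hag a' ha'g ha'j) (hag b' hb'g hb'j)
  rw [hP'] at hPu hPfc
  refine ⟨_, mem_frameConfig_upper.2 ⟨hPu, hPfc⟩, fun f u hfs hft => ?_, ?_, ?_⟩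
  · by_cases hfj : f = j
    · subst hfj; rw [Function.update_self]; exact hwu' u fun hu => hft ⟨rfl, hu⟩
    rw [Function.update_of_ne hfj]
    by_cases hfg : f = g
    · subst hfg; rw [Function.update_self]; exact hwu u fun hu => hfs ⟨rfl, hu⟩
    · rw [Function.update_of_ne hfg]
  · rw [Function.update_of_ne hgj, Function.update_self]; exact hws
  · rw [Function.update_self]; exact hws'

/-- a cover ABOVE the lift of `Y` moving `g` and `j` is the lift of an (F1ℝ) (r2a) cover above. -/
theorem frame_coverAbove {Y : Cell} (hX : frameLift ε Y ∈ C.upper) (hfc : FCMu4 (frameLift ε Y)) {g j : Fin 4}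
    (hgj : g ≠ j) {s t : Fin 2} (h : CoveredAbove C (frameLift ε Y) g (ε g + dirOf s) j (ε j + dirOf t)) :
    CoverAbove (frameConfig ε C) Y g s j t := by
  obtain ⟨a, b, ha, hb, N, hNl, hag, hltg, hrayg, hltj, hrayj⟩ := h
  have hvg : Y g 0 ≠ Y g 1 := ne_of_inU_framePt (hA.uP _ hX g) (hfc g)
  have hvj : Y j 0 ≠ Y j 1 := ne_of_inU_framePt (hA.uP _ hX j) (hfc j)
  have hUg : InUMu4 (ray (framePt (ε g) (Y g)) a ((N g).1 - (frameLift ε Y g).1)) := by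
    have := hA.uN N hNl g; rwa [hrayg] at this
  have hUj : InUMu4 (ray (framePt (ε j) (Y j)) b ((N j).1 - (frameLift ε Y j).1)) := by
    have := hA.uN N hNl j; rwa [hrayj] at this
  obtain ⟨w, hw, hwu, hws⟩ := above_framePt_side hvg (by omega) hUg s ha.ne_add_two
  obtain ⟨w', hw', hwu', hws'⟩ := above_framePt_side hvj (by omega) hUj t hb.ne_add_two
  have hN' : N = frameLift ε (Function.update (Function.update Y g w) j w') := by
    rw [frameLift_update, frameLift_update]; funext f
    by_cases hfj : f = j
    · subst hfj; rw [Function.update_self, hrayj]; exact hw'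
    rw [Function.update_of_ne hfj]
    by_cases hfg : f = g
    · subst hfg; rw [Function.update_self, hrayg]; exact hw
    · rw [Function.update_of_ne hfg]; exact hag f hfg hfj
  obtain ⟨a', ha'g, ha'j, -⟩ := exists_fourth g j j
  obtain ⟨b', hb'g, hb'j, hb'a'⟩ := exists_fourth g j a'
  have hNfc : FCMu4 N := hA.fc_of_agree (Or.inl hNl) hfc (Ne.symm hb'a') (hag a' ha'g ha'j) (hag b' hb'g hb'j)
  rw [hN'] at hNl hNfc
  refine ⟨_, mem_frameConfig_lower.2 ⟨hNl, hNfc⟩, fun f u hfs hft => ?_, ?_, ?_⟩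
  · by_cases hfj : f = j
    · subst hfj; rw [Function.update_self]; exact hwu' u fun hu => hft ⟨rfl, hu⟩
    rw [Function.update_of_ne hfj]
    by_cases hfg : f = g
    · subst hfg; rw [Function.update_self]; exact hwu u fun hu => hfs ⟨rfl, hu⟩
    · rw [Function.update_of_ne hfg]
  · rw [Function.update_of_ne hgj, Function.update_self]; exact hws
  · rw [Function.update_self]; exact hws'

omit hA in
/-- unequal (F1ℝ) coordinates are unequal adapted frame coordinates of the lift. -/
theorem frame_coords {Y : Cell} {g j : Fin 4} {s t : Fin 2} (hne : Y g s ≠ Y j t) :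
    Adapted (frameLift ε Y g) (ε g + dirOf s) ∧ Adapted (frameLift ε Y j) (ε j + dirOf t) ∧
      coord (frameLift ε Y g) (ε g + dirOf s) ≠ coord (frameLift ε Y j) (ε j + dirOf t) := by
  obtain ⟨hadg, hcg⟩ := frame_framePt_side (ε g) (Y g) s
  obtain ⟨hadj, hcj⟩ := frame_framePt_side (ε j) (Y j) t
  refine ⟨hadg, hadj, ?_⟩
  change coord (framePt _ _) _ ≠ coord (framePt _ _) _
  rw [hcg, hcj]
  have : (Y g s : ℤ) ≠ Y j t := by exact_mod_cast hne
  omega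

/-- **THE FRAME TRANSFER**: the fully charged part of an admissible 𝔅(μ₄) configuration, read in any frames `ε`, is an
(F1ℝ)-ADMISSIBLE configuration in the sense of `Pad4TowerXInfB.Admissible` (cells in `𝒰`; RULE D of `Pad4TowerLemmaT` on both
levels — every μ₄ server ∕ cover of a fully charged cell stays in its frames and is fully charged; PSC and X-cleanness hold
vacuously, there being no O-factor). -/
theorem admissible_frameConfig : Admissible (frameConfig ε C) where
  uN Y hY f := inUscr_of_framePt (hA.uN _ (mem_frameConfig_lower.1 hY).1 f)
  uP Y hY f := inUscr_of_framePt (hA.uP _ (mem_frameConfig_upper.1 hY).1 f)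
  ruleD := by
    refine ⟨fun Y hY g j hgj s t hne => ?_, fun Y hY g j hgj s t hne => ?_⟩
    · obtain ⟨hX, hfc⟩ := mem_frameConfig_lower.1 hY
      obtain ⟨hadg, hadj, hne'⟩ := frame_coords ε hne
      rcases hA.ruleD.1 _ hX g j hgj _ _ hadg hadj hne' with ⟨r, hr, P, hPu, hP⟩ | ⟨r, hr, P, hPu, hP⟩ | h
      · exact Or.inl (frame_servedBelow hA ε hX hfc hr hPu hP)
      · exact Or.inr (Or.inl (frame_servedBelow hA ε hX hfc hr hPu hP))
      · exact Or.inr (Or.inr (frame_coverBelow hA ε hX hfc hgj h))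
    · obtain ⟨hX, hfc⟩ := mem_frameConfig_upper.1 hY
      obtain ⟨hadg, hadj, hne'⟩ := frame_coords ε hne
      rcases hA.ruleD.2 _ hX g j hgj _ _ hadg hadj hne' with ⟨r, hr, N, hNl, hN⟩ | ⟨r, hr, N, hNl, hN⟩ | h
      · exact Or.inl (frame_servedAbove hA ε hX hfc hr hNl hN)
      · exact Or.inr (Or.inl (frame_servedAbove hA ε hX hfc hr hNl hN))
      · exact Or.inr (Or.inr (frame_coverAbove hA ε hX hfc hgj h))
  psc Z hZ hO σ := by
    obtain ⟨f, hf⟩ := hO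
    exact absurd ((isO_iff_frameLift ε Z f).1 hf) ((mem_frameConfig_lower.1 hZ).2 f)
  xclean Z hZ f σ _ hO := absurd ((isO_iff_frameLift ε Z f).1 hO) ((mem_frameConfig_lower.1 hZ).2 f)

end Transfer

/-! ## §4 THEOREM X∞ on 𝔅(μ₄) -/

/-- **LEMMA X∞-B on 𝔅(μ₄)**: an admissible 𝔅(μ₄) configuration has NO fully charged cell — by the (F1ℝ) KERNEL THEOREM
`Pad4TowerXInf.Admissible.no_fc` applied to the fully charged part read in the frames of the cell's own phases. -/
theorem AdmissibleMu4.no_fc {C : MConfig} (hA : AdmissibleMu4 C) {X : MCell} (hX : X ∈ C.lower ∨ X ∈ C.upper) :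
    ¬ FCMu4 X := by
  intro hfc
  have hU : ∀ f, InUMu4 (X f) := fun f => hX.elim (fun h => hA.uN X h f) fun h => hA.uP X h f
  have hfr : ∀ f, ∃ k : Fin 4, ∃ v : Fin 2 → ℕ, X f = framePt k v := fun f => by
    rcases (inUMu4_iff _).1 (hU f) with h0 | ⟨k, c, hc, h | h⟩
    · exact absurd h0 (hfc f)
    · refine ⟨k, ![c.toNat, 0], ?_⟩
      rw [h, framePt_eq, lpt_eq]; fin_cases k <;> simp [Prod.ext_iff] <;> omega
    · refine ⟨k, ![(c + 1).toNat, 1], ?_⟩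
      rw [h, framePt_eq, towPt_eq]; fin_cases k <;> simp [Prod.ext_iff] <;> omega
  choose ε Y hY using hfr
  have hXY : frameLift ε Y = X := funext fun f => (hY f).symm
  have hfcY : FC Y := (fc_iff_frameLift ε Y).2 (by rw [hXY]; exact hfc)
  have hmem : Y ∈ (frameConfig ε C).lower ∨ Y ∈ (frameConfig ε C).upper := by
    rcases hX with h | h
    · exact Or.inl (mem_frameConfig_lower.2 (by rw [hXY]; exact ⟨h, hfc⟩))
    · exact Or.inr (mem_frameConfig_upper.2 (by rw [hXY]; exact ⟨h, hfc⟩))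
  exact (admissible_frameConfig hA ε).no_fc Y hmem hfcY

/-- **THEOREM X∞ ON 𝔅(μ₄) — KERNEL FORM, ALL FOUR PHASES** (bc5-plan g4 memo v4.1 df3e4f41db3c2fcf §5 ∕ §6: «the μ₄ statement is
the same with four null directions per factor»): in a finite two-level 𝔅(μ₄) configuration with all letters in `𝒰 = {O} ∪ {c·ℓ_u}
∪ {2I + c·ℓ_u}` (`u ∈ μ₄`, `c ≥ 1` UNBOUNDED), RULE-D-closed (`Pad4TowerRuleDMu4`, PAD4-BALANCED §1′), phase-sibling-closed and
X-clean, EVERY cell is JUNK: all factors but at most one carry `O`. No Ψ-row, no FC1, no universe list, no height bound, no `decide`.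
The (E1)∕(H2) meaning of RULE D and of X-cleanness (LEMMA X-PHASE §22) is the cell's pencil, as everywhere in this directory;
nothing here says HC ∕ HC_CM ∕ HC_AV holds or fails. -/
theorem AdmissibleMu4.junk {C : MConfig} (hA : AdmissibleMu4 C) {X : MCell} (hX : X ∈ C.lower ∨ X ∈ C.upper) :
    ∃ j, ∀ g, g ≠ j → X g = (0, 0, 0) :=
  (hA.junk_or_fc hX).resolve_right (hA.no_fc hX)

/-- THEOREM X∞ on 𝔅(μ₄), counted: at most one charged factor per cell. -/
theorem AdmissibleMu4.card_charged_le_one {C : MConfig} (hA : AdmissibleMu4 C) {X : MCell}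
    (hX : X ∈ C.lower ∨ X ∈ C.upper) : (univ.filter fun g => X g ≠ (0, 0, 0)).card ≤ 1 := by
  obtain ⟨j, hj⟩ := hA.junk hX
  refine Finset.card_le_one.2 fun a ha b hb => ?_
  rw [Finset.mem_filter] at ha hb
  have haj : a = j := by by_contra h; exact ha.2 (hj a h)
  have hbj : b = j := by by_contra h; exact hb.2 (hj b h)
  rw [haj, hbj]

/-! ## §5 The corollary for (H1): the μ-word of a FILE-A design with admissible support vanishes -/

section Design
open Summit.Ventures.HSemireg.Pad4FirstOrder

/-- the SUPPORT of a `Pad4FirstOrderModel.Design` as a 𝔅(μ₄) configuration (classes of its constituents, via the FILE-A seam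
`mcellOfConstituent`; multiplicities forgotten). -/
def designConfig (D : Design) : MConfig :=
  ⟨(D.lower.map mcellOfConstituent).toFinset, (D.upper.map mcellOfConstituent).toFinset⟩

/-- a constituent with at most one charged class factor has `Π_f β_f = 0`. -/
theorem muTerm_eq_zero_of_junk {X : Constituent} (h : ∃ j, ∀ g, g ≠ j → mcellOfConstituent X g = (0, 0, 0)) :
    X.muTerm = 0 := by
  obtain ⟨j, hj⟩ := h
  obtain ⟨g, hgj, -⟩ := exists_fourth j j j
  have h0 := hj g hgj
  simp only [mcellOfConstituent, bpointOfConstituent, Prod.mk.injEq] at h0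
  exact Finset.prod_eq_zero (Finset.mem_univ g) (Zsqrtd.ext h0.2.1 h0.2.2)

/-- **COROLLARY (¬(H1)) on 𝔅(μ₄)**: a FILE-A design (`Pad4FirstOrderModel.Design`: constituents `t·h + Σ c_f ℓ_{ζ_f}`, any
phases `ζ_f ∈ μ₄`, multiplicities by repetition) whose support is an admissible 𝔅(μ₄) configuration has `μ = 0`, i.e. violates
(H1) — memo §5 COROLLARY, with NO Ψ-row hypothesis. (Within FILE A's class this concerns the layer-`0` = pure-ray constituents and
the all-tower layer-`2` ones; mixed ray∕tower cells of `𝒰` are not FILE-A constituents.) -/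
theorem _root_.Summit.Ventures.HSemireg.Pad4FirstOrder.Design.mu_eq_zero_of_admissibleMu4 (D : Design)
    (hA : AdmissibleMu4 (designConfig D)) : D.mu = 0 := by
  have hz : ∀ l : List Constituent,
      (∀ X ∈ l, mcellOfConstituent X ∈ (designConfig D).lower ∨ mcellOfConstituent X ∈ (designConfig D).upper) →
      (l.map Constituent.muTerm).sum = 0 := fun l hl =>
    List.sum_eq_zero fun x hx => by
      obtain ⟨X, hX, rfl⟩ := List.mem_map.1 hx
      exact muTerm_eq_zero_of_junk (hA.junk (hl X hX))
  unfold Design.mu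
  rw [hz D.lower fun X hX => Or.inl (List.mem_toFinset.2 (List.mem_map.2 ⟨X, hX, rfl⟩)),
    hz D.upper fun X hX => Or.inr (List.mem_toFinset.2 (List.mem_map.2 ⟨X, hX, rfl⟩)), sub_zero]

/-- the same, as the negation of FILE A's `Design.H1`. -/
theorem _root_.Summit.Ventures.HSemireg.Pad4FirstOrder.Design.not_H1_of_admissibleMu4 (D : Design)
    (hA : AdmissibleMu4 (designConfig D)) : ¬ D.H1 := fun h =>
  h (D.mu_eq_zero_of_admissibleMu4 hA)

end Design

/-! ## §6 Non-vacuity: a genuinely four-phase admissible configuration (junk, as the theorem says) -/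

/-- `lower = {[O|O|O|2ℓ_u] : u ∈ μ₄}`, `upper = {[O|O|O|ℓ_u] : u ∈ μ₄}`. -/
def junkExampleMu4 : MConfig where
  lower := {mcellOf ptO ptO ptO (lpt 2 0), mcellOf ptO ptO ptO (lpt 2 1), mcellOf ptO ptO ptO (lpt 2 2),
    mcellOf ptO ptO ptO (lpt 2 3)}
  upper := {mcellOf ptO ptO ptO (lpt 1 0), mcellOf ptO ptO ptO (lpt 1 1), mcellOf ptO ptO ptO (lpt 1 2),
    mcellOf ptO ptO ptO (lpt 1 3)}

set_option synthInstance.maxSize 8192 in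
set_option synthInstance.maxHeartbeats 2000000 in -- the unfolded predicates are large decidable instances
/-- the example IS admissible (so `AdmissibleMu4` is satisfiable with all four phases present): letters in `𝒰`; RULE D holds (each
`2ℓ_u` is served own-down by `ℓ_u`, each `ℓ_u` own-up by `2ℓ_u`; O-coordinates agree); PSC holds (all four rotations present);
X-clean (no full cancellation `[O|O|O|O]` is a `P`-cell). [kernel, `decide`] -/
theorem junkExampleMu4_admissible : AdmissibleMu4 junkExampleMu4 where
  uN := by decide
  uP := by decide
  ruleD := by constructor <;> decide +kernel
  psc := by decide +kernel
  xclean Z hZ f σ _ _ k c _ _ h := by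
    have hno : ∀ Z ∈ junkExampleMu4.lower, ∀ σ, Function.update Z σ (0, 0, 0) ∉ junkExampleMu4.upper := by
      decide +kernel
    exact hno Z hZ σ h.1

end Summit.Ventures.HSemireg.Pad4Tower
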